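import Mathlib
import HarnessLib
import Summits.Ventures.LatticeQCDFlow.Scoring.SectorMinESS
import Summits.Ventures.LatticeQCDFlow.Scoring.PooledESS

/-!
# The structural ceiling of the worst-sector figure: `ESS_min ≤ N / |R|`

HONEST FRAMING: exact (Metropolis-corrected) sampling algorithms for lattice gauge theory;
figures of merit are autocorrelation/cost numbers at stated couplings and volumes; no
continuum-physics claim.

Venture `LatticeQCDFlow` (cell pub-lqcd), sub-topic `Scoring`; FANOUT row 11 (`eng-scorerA`,
fitness scorer A).  NEW WORK of the cell (elementary finite-sum bookkeeping), not a published
result; nothing is cited as a fact.  Companion of `SectorMinESS` (which sectors enter the minimum)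
and `PooledESS` (Kish ESS of a finite weight family).

## Content

FITNESS §1 / FITNESS-A §A3 define the worst-sector figure of a scored run of `N` pooled samples as
`F₂ = ESS_min / C_total` with `ESS_min = min_{k ∈ R} ESS_k` over the reference set `R` of
topological sectors (`SectorMinESS.essMin`).  In BOTH scoring modes the per-sector effective count
is bounded by the per-sector SAMPLE count `N_k = #{i : Q_i = k}`:

* chain mode: `ESS_k = N_k / (2 τ_int(1[Q = k]))`, which is `≤ N_k` under the HYPOTHESIS
  `τ_int ≥ 1/2` (`chainSectorESS_le_count`) — true in population for every observable of an exact
  independence-Metropolis chain (`IMHPositiveCorrelations`: nonnegative autocovariances), NOT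
  automatic for HMC-type updates or for the Γ-ESTIMATED `τ̂` (an estimate below `1/2` is exactly the
  board's `W-NEFF-GT-N` case, where `ESS_k > N_k` is reported and this ceiling does not apply as
  stated);
* reweight mode: `ESS_k` is the Kish count of the weights restricted to the sector, and
  `Kish ≤ #` (`PooledESS.kishESS_le_card`).

Since the sectors partition the sample, `Σ_{k ∈ R} N_k ≤ N`
(`sum_sectorCount_le_card`), and a minimum is at most the mean, so

  `ESS_min ≤ (Σ_{k ∈ R} ESS_k) / |R| ≤ (Σ_{k ∈ R} N_k) / |R| ≤ N / |R|`

(`essMin_le_sum_div_card`, `essMin_le_div_card`, and the mode-specific corollaries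
`essMin_chain_le_div_card`, `essMin_kish_le_div_card`).  Equivalently, **a worst-sector effective
count of at least `m` on `|R|` reference sectors needs `N ≥ |R| · m` pooled samples whatever the
sampler** (`card_mul_le_of_le_essMin`).  The ceiling is attained exactly by a run that spreads its
samples evenly over `R` with white indicator series (`essMin_const`), so it cannot be improved
from the bookkeeping alone.

With EXACT reference weights and floor `θ > 0` the reference set has at most `1/θ` members
(`card_refSet_mul_floor_le_one`: `|R| · θ ≤ Σ_{k ∈ R} π_k ≤ 1`), so the structural ceiling is never
below `θ · N` (`floor_mul_le_div_card_refSet`); at FITNESS's `θ = 1/100` that is `N / 100`.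

Reading for the record (ref-exact advisory F29-1 on LEADERBOARD l.30–32, SU(3) β 6.0 16⁴, `N = 500`
non-equilibrium evolutions, nine reference sectors `|Q| ≤ 4`): `ESS_min ≤ 500/9 < 56` for ANY
sampler at that statistics (`essMin_ceiling_l30_32`), and a worst-sector count of `100` on nine
sectors needs `N ≥ 900` (`samples_needed_nine_sectors`) — the boarded `7.15 / 6.53 / 4.37` are
low first of all because `N` is; raw `F₂` comparisons at fixed small `N` and different `|R|` compare
ceilings as much as samplers, which is the arithmetic behind 'rank on `F₃`/γ₂ until `N` grows'.
-/

namespace Summit.Ventures.LatticeQCDFlow.Scoring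

open Finset

variable {ι κ : Type*}

/-! ### A minimum is at most the mean -/

/-- `|R| · ESS_min ≤ Σ_{k ∈ R} ESS_k`. -/
theorem card_mul_essMin_le_sum {R : Finset κ} (hR : R.Nonempty) (ess : κ → ℝ) :
    (R.card : ℝ) * essMin R hR ess ≤ ∑ k ∈ R, ess k := by
  have h := card_nsmul_le_sum R ess (essMin R hR ess) fun k hk => essMin_le hR ess hk
  simpa [nsmul_eq_mul] using h

/-- **Minimum ≤ mean**: `ESS_min ≤ (Σ_{k ∈ R} ESS_k) / |R|`. -/
theorem essMin_le_sum_div_card {R : Finset κ} (hR : R.Nonempty) (ess : κ → ℝ) :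
    essMin R hR ess ≤ (∑ k ∈ R, ess k) / R.card := by
  have hc : (0 : ℝ) < R.card := by exact_mod_cast hR.card_pos
  rw [le_div_iff₀ hc, mul_comm]
  exact card_mul_essMin_le_sum hR ess

/-- **The structural ceiling**: if every reference sector's effective count is at most its sample
count, `ESS_k ≤ N_k`, and the reference sectors hold at most `N` samples between them, then
`ESS_min ≤ N / |R|`. -/
theorem essMin_le_div_card {R : Finset κ} (hR : R.Nonempty) {ess cnt : κ → ℝ} {N : ℝ}
    (hle : ∀ k ∈ R, ess k ≤ cnt k) (hsum : ∑ k ∈ R, cnt k ≤ N) :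
    essMin R hR ess ≤ N / R.card := by
  have hc : (0 : ℝ) < R.card := by exact_mod_cast hR.card_pos
  calc essMin R hR ess ≤ (∑ k ∈ R, ess k) / R.card := essMin_le_sum_div_card hR ess
    _ ≤ (∑ k ∈ R, cnt k) / R.card := by
        gcongr with k hk
        exact hle k hk
    _ ≤ N / R.card := by gcongr

/-- **Sample budget**: a worst-sector effective count of at least `m` on the reference set needs
`|R| · m ≤ N` pooled samples (contrapositive reading of the ceiling). -/
theorem card_mul_le_of_le_essMin {R : Finset κ} (hR : R.Nonempty) {ess cnt : κ → ℝ} {N m : ℝ}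
    (hle : ∀ k ∈ R, ess k ≤ cnt k) (hsum : ∑ k ∈ R, cnt k ≤ N) (hm : m ≤ essMin R hR ess) :
    (R.card : ℝ) * m ≤ N := by
  have hc : (0 : ℝ) < R.card := by exact_mod_cast hR.card_pos
  have h := hm.trans (essMin_le_div_card hR hle hsum)
  rwa [le_div_iff₀ hc, mul_comm] at h

/-- The ceiling is attained: a run whose reference sectors all carry the same effective count `c`
(even spread, white indicator series) has `ESS_min = c`; with `c = N / |R|` this is the ceiling
itself, so `N / |R|` cannot be improved from the bookkeeping alone. -/
theorem essMin_const {R : Finset κ} (hR : R.Nonempty) (c : ℝ) :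
    essMin R hR (fun _ => c) = c := by
  obtain ⟨k, hk⟩ := hR
  exact le_antisymm (essMin_le ⟨k, hk⟩ _ hk) ((le_essMin_iff ⟨k, hk⟩ _).2 fun _ _ => le_rfl)

/-! ### The sectors partition the sample: `Σ_{k ∈ R} N_k ≤ N` -/

section Counts

variable [DecidableEq κ]

/-- The sample count of sector `k`: the number of pooled samples `i ∈ s` with label `Q i = k`. -/
def sectorCount (s : Finset ι) (Q : ι → κ) (k : κ) : ℕ :=
  (s.filter fun i => Q i = k).card

/-- The reference sectors hold at most all the samples: `Σ_{k ∈ R} N_k ≤ #s` (with equality when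
every sample's sector lies in `R`). -/
theorem sum_sectorCount_le_card (s : Finset ι) (Q : ι → κ) (R : Finset κ) :
    ∑ k ∈ R, sectorCount s Q k ≤ s.card := by
  unfold sectorCount
  rw [sum_card_fiberwise_eq_card_filter]
  exact card_filter_le _ _

/-- The same inequality over `ℝ`. -/
theorem sum_sectorCount_le_card_real (s : Finset ι) (Q : ι → κ) (R : Finset κ) :
    ∑ k ∈ R, (sectorCount s Q k : ℝ) ≤ s.card := by
  exact_mod_cast sum_sectorCount_le_card s Q R

end Counts

/-! ### Chain mode: `ESS_k = N_k / (2 τ_k) ≤ N_k` -/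

/-- The chain-mode per-sector effective count of FITNESS-A §A3: `N_k / (2 τ_int(1[Q = k]))`. -/
noncomputable def chainSectorESS (cnt τ : ℝ) : ℝ :=
  cnt / (2 * τ)

/-- Under the hypothesis `τ_int ≥ 1/2` (white or positively correlated indicator series — e.g. any
exact independence-Metropolis chain, `IMHPositiveCorrelations`) the chain-mode effective count is at
most the sample count.  (A Γ-estimate `τ̂ < 1/2` = the board's `W-NEFF-GT-N` case is outside this
lemma.) -/
theorem chainSectorESS_le_count {cnt τ : ℝ} (hcnt : 0 ≤ cnt) (hτ : 1 / 2 ≤ τ) :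
    chainSectorESS cnt τ ≤ cnt := by
  unfold chainSectorESS
  have h2τ : 1 ≤ 2 * τ := by linarith
  have hpos : 0 < 2 * τ := by linarith
  rw [div_le_iff₀ hpos]
  nlinarith

/-- At `τ_int = 1/2` exactly (white indicator series) the effective count IS the sample count. -/
theorem chainSectorESS_half (cnt : ℝ) : chainSectorESS cnt (1 / 2) = cnt := by
  unfold chainSectorESS
  norm_num

/-- **Chain-mode ceiling**: `min_{k ∈ R} N_k / (2 τ_k) ≤ #s / |R|` for any labelled sample `s`
and any `τ_k ≥ 1/2`. -/
theorem essMin_chain_le_div_card [DecidableEq κ] (s : Finset ι) (Q : ι → κ) {R : Finset κ}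
    (hR : R.Nonempty) (τ : κ → ℝ) (hτ : ∀ k ∈ R, 1 / 2 ≤ τ k) :
    essMin R hR (fun k => chainSectorESS (sectorCount s Q k) (τ k)) ≤ (s.card : ℝ) / R.card :=
  essMin_le_div_card hR (cnt := fun k => (sectorCount s Q k : ℝ))
    (fun k hk => chainSectorESS_le_count (Nat.cast_nonneg _) (hτ k hk))
    (sum_sectorCount_le_card_real s Q R)

/-! ### Reweight mode: per-sector Kish `≤ N_k` -/

/-- **Reweight-mode ceiling**: the per-sector Kish counts of ANY weights satisfy
`min_{k ∈ R} Kish(s_k, w) ≤ #s / |R|`, `s_k = {i ∈ s | Q i = k}`. -/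
theorem essMin_kish_le_div_card [DecidableEq κ] (s : Finset ι) (Q : ι → κ) (w : ι → ℝ)
    {R : Finset κ} (hR : R.Nonempty) :
    essMin R hR (fun k => kishESS (s.filter fun i => Q i = k) w) ≤ (s.card : ℝ) / R.card :=
  essMin_le_div_card hR (cnt := fun k => (sectorCount s Q k : ℝ))
    (fun k _ => by simpa [sectorCount] using kishESS_le_card (s.filter fun i => Q i = k) w)
    (sum_sectorCount_le_card_real s Q R)

/-! ### Exact reference weights: `|R| ≤ 1/θ`, so the ceiling is never below `θ N` -/

/-- With nonnegative reference weights of total mass at most `1` on the candidate sectors, the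
reference set at floor `θ` satisfies `|R| · θ ≤ 1` (each member weighs at least `θ`). -/
theorem card_refSet_mul_floor_le_one {S : Finset κ} {π : κ → ℝ} {θ : ℝ}
    (hπ : ∀ k ∈ S, 0 ≤ π k) (hsum : ∑ k ∈ S, π k ≤ 1) :
    ((refSet S π θ).card : ℝ) * θ ≤ 1 := by
  have h1 : ((refSet S π θ).card : ℝ) * θ ≤ ∑ k ∈ refSet S π θ, π k := by
    have h := card_nsmul_le_sum (refSet S π θ) π θ fun k hk => (mem_refSet.1 hk).2
    simpa [nsmul_eq_mul] using h
  have h2 : ∑ k ∈ refSet S π θ, π k ≤ ∑ k ∈ S, π k :=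
    sum_le_sum_of_subset_of_nonneg (refSet_subset S π θ) fun k hk _ => hπ k hk
  exact h1.trans (h2.trans hsum)

/-- Hence `|R| ≤ 1/θ` for a positive floor (at `θ = 1/100`: at most `100` reference sectors). -/
theorem card_refSet_le_inv_floor {S : Finset κ} {π : κ → ℝ} {θ : ℝ} (hθ : 0 < θ)
    (hπ : ∀ k ∈ S, 0 ≤ π k) (hsum : ∑ k ∈ S, π k ≤ 1) :
    ((refSet S π θ).card : ℝ) ≤ 1 / θ := by
  rw [le_div_iff₀ hθ]
  exact card_refSet_mul_floor_le_one hπ hsum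

/-- **The structural ceiling is never below `θ N`**: `θ · N ≤ N / |R|` for the exact-weight
reference set (nonempty, `N ≥ 0`; for `θ ≤ 0` the bound is trivial). -/
theorem floor_mul_le_div_card_refSet {S : Finset κ} {π : κ → ℝ} {θ N : ℝ}
    (hN : 0 ≤ N) (hπ : ∀ k ∈ S, 0 ≤ π k) (hsum : ∑ k ∈ S, π k ≤ 1)
    (hR : (refSet S π θ).Nonempty) :
    θ * N ≤ N / (refSet S π θ).card := by
  have hc : (0 : ℝ) < (refSet S π θ).card := by exact_mod_cast hR.card_pos
  rw [le_div_iff₀ hc]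
  calc θ * N * (refSet S π θ).card = N * (((refSet S π θ).card : ℝ) * θ) := by ring
    _ ≤ N * 1 := by gcongr; exact card_refSet_mul_floor_le_one hπ hsum
    _ = N := mul_one N

/-! ### The record's numbers (LEADERBOARD l.30–32; ref-exact advisory F29-1) -/

/-- SU(3) β 6.0 16⁴ non-equilibrium rows at `N = 500` evolutions with nine reference sectors
(`|Q| ≤ 4`): whatever the sampler, `ESS_min ≤ 500 / 9 < 56`. -/
theorem essMin_ceiling_l30_32 {R : Finset ℤ} (hR : R.Nonempty) (hcard : R.card = 9)
    {ess cnt : ℤ → ℝ} (hle : ∀ k ∈ R, ess k ≤ cnt k) (hsum : ∑ k ∈ R, cnt k ≤ 500) :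
    essMin R hR ess < 56 := by
  have h := essMin_le_div_card hR hle hsum
  rw [hcard] at h
  have h56 : (500 : ℝ) / (9 : ℕ) < 56 := by norm_num
  exact h.trans_lt h56

/-- A worst-sector effective count of `100` on nine reference sectors needs at least `900`
pooled samples. -/
theorem samples_needed_nine_sectors {R : Finset ℤ} (hR : R.Nonempty) (hcard : R.card = 9)
    {ess cnt : ℤ → ℝ} {N : ℝ} (hle : ∀ k ∈ R, ess k ≤ cnt k) (hsum : ∑ k ∈ R, cnt k ≤ N)
    (hm : 100 ≤ essMin R hR ess) : 900 ≤ N := by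
  have h := card_mul_le_of_le_essMin hR hle hsum hm
  rw [hcard] at h
  norm_num at h
  linarith

end Summit.Ventures.LatticeQCDFlow.Scoring
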